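import Summits.AtomisticToContinuum.Crystallization.Theorems.OverbindingBudgetAffineRunCutWord
import Summits.AtomisticToContinuum.Crystallization.Theorems.OverbindingBudgetAffineTwinGainWide

/-!
# «RunCut» S2, the certified column gain (lens-4, g85)

Word-level class calculus (`…RunCutWord`) + the widened-box LJ margins with partial tails (`…TwinGainWide`) ⇒ for the Lennard-Jones Barlow
couplings `J_k(a) = barlowCoupling lennardJones a (a√(2/3)) k` at ANY own-scale `a ∈ [21/25, 101/50]`, ANY range `K ≥ 2`, ANY column window:

* `triple_column_gain` — `∑_{|m−j| ≤ M} [E_K(tripleFlip j s)(m) − E_K(s)(m)] ≤ −1/250000`  (six equal steps around `j`, `M ≥ 3`);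
* `swap_column_gain`   — `∑_{|m−j| ≤ M} [E_K(swapFlip j s)(m) − E_K(s)(m)] ≤ −1/500000`   (five equal steps, `M ≥ 2`).

This is the IDEAL (undistorted, laterally complete) part of the competitor's per-column energy identity (memo `g85/memo/SW-S3.md` §3, §6 S2);
the distortion / roughness / far-matter corrections of §4 are charged against the PROFILE versions (`…TwinGainWide.…_profile`).
[this file: 0 definitions, 3 theorems, 0 sorry]
-/

noncomputable section

namespace Summit.AtomisticToContinuum.Crystallization.Theorems.OverbindingBudgetAffineRunCutColumnGain

open Finset
open Literature.MathematicalPhysics.StatisticalMechanics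
open Summit.AtomisticToContinuum.Crystallization.Theorems.OverbindingBudgetAffineRunCutWord
open Summit.AtomisticToContinuum.Crystallization.Theorems.OverbindingBudgetAffineTwinGainWide

/-- Reindexing `∑_{k=3}^{K} f k = ∑_{i<K−2} f (i+2+1)`. -/
theorem sum_Icc_three_eq_sum_range (f : ℕ → ℝ) (K : ℕ) :
    ∑ k ∈ Icc 3 K, f k = ∑ i ∈ range (K - 2), f (i + 2 + 1) := by
  have h : Icc 3 K = (range (K - 2)).map ⟨fun i => i + 2 + 1, fun a b hab => by simpa using hab⟩ := by
    ext k
    simp only [mem_Icc, mem_map, mem_range, Function.Embedding.coeFn_mk]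
    constructor
    · intro hk
      exact ⟨k - 3, by omega, by omega⟩
    · rintro ⟨i, hi, rfl⟩
      omega
  rw [h, sum_map]
  rfl

/-- ★ **THE CERTIFIED TRIPLE COLUMN GAIN**: own-scale `a ∈ [21/25, 101/50]`, Hägg word with six equal steps `s(j−3) = ⋯ = s(j+2)`,
range `K ≥ 2`, window `M ≥ 3`: the range-`K` stacking energy of the column drops by at least `1/250000` under the TRIPLE slip. [this file · kind: proof] -/
theorem triple_column_gain {a : ℝ} (ha1 : 21 / 25 ≤ a) (ha2 : a ≤ 101 / 50) {s : ℤ → ℤ} {j : ℤ} (hs : IsHaggSeq s)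
    (hrun6 : s (j - 3) = s (j - 2) ∧ s (j - 2) = s (j - 1) ∧ s (j - 1) = s j ∧ s j = s (j + 1) ∧ s (j + 1) = s (j + 2))
    {K M : ℕ} (hK : 2 ≤ K) (hM : 3 ≤ M) :
    ∑ m ∈ Icc (j - M) (j + M),
        (haggLocalEnergyTrunc K (barlowCoupling lennardJones a (a * Real.sqrt (2 / 3))) (tripleFlip j s) m
          - haggLocalEnergyTrunc K (barlowCoupling lennardJones a (a * Real.sqrt (2 / 3))) s m) ≤ -(1 / 250000) := by
  have h1 := triple_localEnergyTrunc_le hs hrun6 (barlowCoupling lennardJones a (a * Real.sqrt (2 / 3))) hK hM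
  rw [sum_Icc_three_eq_sum_range] at h1
  have h2 := tripleGain_partial_margin_wide ha1 ha2 (K - 2)
  linarith

/-- ★ **THE CERTIFIED SWAP COLUMN GAIN**: own-scale `a ∈ [21/25, 101/50]`, five equal steps `s(j−2) = ⋯ = s(j+2)`, `K ≥ 2`, `M ≥ 2`:
the range-`K` stacking energy of the column drops by at least `1/500000` under the SWAP slip. [this file · kind: proof] -/
theorem swap_column_gain {a : ℝ} (ha1 : 21 / 25 ≤ a) (ha2 : a ≤ 101 / 50) {s : ℤ → ℤ} {j : ℤ} (hs : IsHaggSeq s)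
    (hrun5 : s (j - 2) = s (j - 1) ∧ s (j - 1) = s j ∧ s j = s (j + 1) ∧ s (j + 1) = s (j + 2))
    {K M : ℕ} (hK : 2 ≤ K) (hM : 2 ≤ M) :
    ∑ m ∈ Icc (j - M) (j + M),
        (haggLocalEnergyTrunc K (barlowCoupling lennardJones a (a * Real.sqrt (2 / 3))) (swapFlip j s) m
          - haggLocalEnergyTrunc K (barlowCoupling lennardJones a (a * Real.sqrt (2 / 3))) s m) ≤ -(1 / 500000) := by
  have h1 := swap_localEnergyTrunc_le hs hrun5 (barlowCoupling lennardJones a (a * Real.sqrt (2 / 3))) hK hM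
  rw [sum_Icc_three_eq_sum_range] at h1
  have h2 := twinGain_partial_margin_wide ha1 ha2 (K - 2)
  linarith

end Summit.AtomisticToContinuum.Crystallization.Theorems.OverbindingBudgetAffineRunCutColumnGain

end
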